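import Literature.AnabelianGeometry.AbsoluteAnabelian.AbsTopIII.Thm19CuspidalDegreeUnique
import Literature.AnabelianGeometry.AbsoluteAnabelian.AbsTopIII.Thm19BaseChangeCoefficients
import Literature.AnabelianGeometry.AbsoluteAnabelian.AbsTopIII.Thm19PUgtProofs
import HarnessLib

/-!
# [AbsTopIII] §1: restriction of `H¹`-classes with cyclotome coefficients to subgroups — vanishing on a
# subgroup is vanishing of a crossed homomorphism up to a principal one (proof-only)

Mochizuki, *Topics in Absolute Anabelian Geometry III*, §1, Prop. 1.6 (iii) p. 35 / Prop. 1.8 p. 36 (lit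
key `paper:url-5493eb38cbb7`): "restricting cohomology classes of `Π_U` to the various `I_x`",
"`η|_{x} := s_x^*(η)`"; the classical description `H¹ = ` continuous crossed homomorphisms modulo
principal ones [cite: SerreGaloisCohomology1997, I §2.3].

Generic lemmas on the restriction maps `cyclotomeModH1Res r Λ D : H¹(Π_V, M_X(Λ)) → H¹(D, M_X(Λ))`
(abc-iut; consumed by the (e)-bridge of Thm. 1.9, VALUES part): by the tree's representability
(`exists_crossedHomClass_eq`), functoriality (`map_crossedHomClass`) and principal criterion
(`crossedHomClass_eq_zero_iff`) of crossed-homomorphism classes,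

* `res_crossedHomClass_eq_zero_iff` — `[f]|_D = 0 ↔ ∃ v, ∀ d ∈ D, f d = d v − v`;
* `res_conj_eq_zero_iff` — vanishing on `g D g⁻¹` ↔ vanishing on `D`;
* `res_pull_eq_zero_iff` — for a pull-back along `φ : Π_{V′} → Π_V`: `(φ^* η)|_D = 0 ↔ η|_{φ(D)} = 0`
  (both directions are formal: the principal vector serves on either side);
* `res_push_eq_zero_iff` — for the change of coefficients along a BASE-CHANGE homomorphism
  (`cyclotomeModPush` bijective, abc-iut-w5-d099): `(f_* η)|_D = 0 ↔ η|_D = 0`.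

All theorems; no definition, no new named fact; nothing here bears on [IUTchIII] Cor. 3.12.
-/

noncomputable section

open CategoryTheory
open scoped Pointwise

namespace Literature.AnabelianGeometry.AbsoluteAnabelian.AbsTopIII

universe u

section Res

variable {E'' E' E F : FundamentalExtension.{u}} (Λ : Type u) [AddCommGroup Λ] [TopologicalSpace Λ]
  [IsTopologicalAddGroup Λ] (r : E' ⟶ E)

/-- **Vanishing of the restriction of a crossed-homomorphism class to a subgroup**: `[f]|_D = 0` iff `f`
is PRINCIPAL on `D`, i.e. `f d = d·v − v` (`d ∈ D`) for some vector `v` (the orbit map `d ↦ d·v = f d + v`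
is then automatically continuous). [cite: SerreGaloisCohomology1997, I §2.3] -/
theorem res_crossedHomClass_eq_zero_iff (D : Subgroup E'.arith)
    (f : C(E'.arith, TopRep.res (r.arith : E'.arith →* E.arith) (cyclotomeModTopRep E Λ)))
    (hf : ∀ x y, f (x * y) = f x + cyclotomeModRep E Λ (r.arith x) (f y)) :
    (cyclotomeModH1Res r Λ D).hom (ContinuousCohomology.crossedHomClass _ f hf) = 0 ↔
      ∃ v : CyclotomeMod E Λ, ∀ d : D, f d = cyclotomeModRep E Λ (r.arith d) v - v := by
  unfold cyclotomeModH1Res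
  rw [ContinuousCohomology.map_crossedHomClass, ContinuousCohomology.crossedHomClass_eq_zero_iff]
  constructor
  · rintro ⟨v, -, hv⟩
    exact ⟨v, fun d => hv d⟩
  · rintro ⟨v, hv⟩
    refine ⟨v, ?_, fun d => hv d⟩
    have h1 : (fun d : D => cyclotomeModRep E Λ (r.arith d) v) = fun d : D => f d + v := by
      funext d
      change _ = f d + v
      rw [hv d, sub_add_cancel]
    change Continuous fun d : D => cyclotomeModRep E Λ (r.arith d) v
    rw [h1]
    exact (f.continuous.comp continuous_subtype_val).add continuous_const

/-- Crossed homomorphisms vanish at `1`. [cite: SerreGaloisCohomology1997, I §2.3] -/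
theorem crossedHom_one
    (f : C(E'.arith, TopRep.res (r.arith : E'.arith →* E.arith) (cyclotomeModTopRep E Λ)))
    (hf : ∀ x y, f (x * y) = f x + cyclotomeModRep E Λ (r.arith x) (f y)) : f 1 = 0 := by
  have h := hf 1 1
  have h1 : cyclotomeModRep E Λ (r.arith 1) = 1 := by rw [map_one, map_one]
  rw [mul_one, h1] at h
  change f 1 = f 1 + f 1 at h
  have h5 : f 1 + f 1 = f 1 + 0 := by rw [add_zero]; exact h.symm
  exact add_left_cancel h5

/-- A principal vector on `D` yields a principal vector on `g D g⁻¹`: if `f d = d·v − v` on `D` then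
`f d′ = d′·w − w` on `g D g⁻¹` with `w = g·v − f(g)`. [cite: SerreGaloisCohomology1997, I §2.3] -/
theorem principal_conj (D : Subgroup E'.arith) (g : E'.arith)
    (f : C(E'.arith, TopRep.res (r.arith : E'.arith →* E.arith) (cyclotomeModTopRep E Λ)))
    (hf : ∀ x y, f (x * y) = f x + cyclotomeModRep E Λ (r.arith x) (f y)) (v : CyclotomeMod E Λ)
    (hv : ∀ d : D, f d = cyclotomeModRep E Λ (r.arith d) v - v) (d' : ↥(MulAut.conj g • D)) :
    f d' = cyclotomeModRep E Λ (r.arith d') (cyclotomeModRep E Λ (r.arith g) v - f g) -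
      (cyclotomeModRep E Λ (r.arith g) v - f g) := by
  obtain ⟨d', hd⟩ := d'
  rw [Subgroup.mem_pointwise_smul_iff_inv_smul_mem, MulAut.smul_def, MulAut.conj_inv_apply] at hd
  -- abbreviation for the action through `r`
  set ρ : E'.arith →* (CyclotomeMod E Λ →L[ℤ] CyclotomeMod E Λ) :=
    (cyclotomeModRep E Λ : E.arith →* _).comp r.arith.toMonoidHom with hρ
  have hρa : ∀ x, cyclotomeModRep E Λ (r.arith x) = ρ x := fun x => rfl
  simp only [hρa] at hf hv ⊢
  change f d' = ρ d' (ρ g v - f g) - (ρ g v - f g)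
  have h1 := hv ⟨_, hd⟩
  change f (g⁻¹ * d' * g) = ρ (g⁻¹ * d' * g) v - v at h1
  -- `ρ g (f g⁻¹) = - f g`
  have h0 : f 1 = 0 := crossedHom_one Λ r f (fun x y => by rw [hf]; rfl)
  have hinv : ρ g (f g⁻¹) = -f g := by
    have h := hf g g⁻¹
    rw [mul_inv_cancel, h0] at h
    exact (neg_eq_of_add_eq_zero_right h.symm).symm
  -- expand `f d' = f (g * (g⁻¹ d' g) * g⁻¹)`
  have hd' : g * (g⁻¹ * d' * g) * g⁻¹ = d' := by group
  have h2 : f d' = f g + ρ g (f (g⁻¹ * d' * g)) + ρ (d' * g) (f g⁻¹) := by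
    conv_lhs => rw [← hd']
    rw [hf (g * (g⁻¹ * d' * g)) g⁻¹, hf g (g⁻¹ * d' * g)]
    congr 2
    congr 1
    group
  have hmul : ∀ (x y : E'.arith) (w : CyclotomeMod E Λ), ρ (x * y) w = ρ x (ρ y w) := fun x y w => by
    rw [map_mul]; rfl
  have ea : ρ (d' * g) (f g⁻¹) = ρ d' (-f g) := by rw [hmul, hinv]
  have eb : ρ g (ρ (g⁻¹ * d' * g) v) = ρ d' (ρ g v) := by
    rw [← hmul, show g * (g⁻¹ * d' * g) = d' * g by group, hmul]
  rw [h2, h1, map_sub, eb, ea, map_neg, map_sub]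
  abel

/-- **Vanishing on a subgroup is conjugation-invariant**: `η|_{g D g⁻¹} = 0 ↔ η|_D = 0`.
[cite: SerreGaloisCohomology1997, I §2.3] -/
theorem res_conj_eq_zero_iff (D : Subgroup E'.arith) (g : E'.arith) (η : cyclotomeModH1 r Λ) :
    (cyclotomeModH1Res r Λ (MulAut.conj g • D)).hom η = 0 ↔ (cyclotomeModH1Res r Λ D).hom η = 0 := by
  obtain ⟨f, hf, rfl⟩ := ContinuousCohomology.exists_crossedHomClass_eq _ η
  rw [res_crossedHomClass_eq_zero_iff, res_crossedHomClass_eq_zero_iff]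
  constructor
  · rintro ⟨v, hv⟩
    refine ⟨cyclotomeModRep E Λ (r.arith g⁻¹) v - f g⁻¹, fun d => ?_⟩
    have hmem : (d : E'.arith) ∈ MulAut.conj g⁻¹ • MulAut.conj g • D := by
      rw [← mul_smul, ← map_mul, inv_mul_cancel, map_one, one_smul]; exact d.2
    exact principal_conj Λ r (MulAut.conj g • D) g⁻¹ f hf v hv ⟨d, hmem⟩
  · rintro ⟨v, hv⟩
    exact ⟨cyclotomeModRep E Λ (r.arith g) v - f g, principal_conj Λ r D g f hf v hv⟩

/-- **Restriction after pull-back**: for a homomorphism of extensions `φ : Π_{V′} → Π_V` over `Π_X` and a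
subgroup `D ≤ Π_{V′}`, `(φ^* η)|_D = 0 ↔ η|_{φ(D)} = 0` (the same principal vector serves on both sides).
[cite: SerreGaloisCohomology1997, I §2.4] -/
theorem res_pull_eq_zero_iff (φ : E'' ⟶ E') (r' : E'' ⟶ E) (hr : φ ≫ r = r') (D : Subgroup E''.arith)
    (η : cyclotomeModH1 r Λ) :
    (cyclotomeModH1Res r' Λ D).hom ((cyclotomeModH1Pull Λ φ r r' hr).hom η) = 0 ↔
      (cyclotomeModH1Res r Λ (D.map φ.arith.toMonoidHom)).hom η = 0 := by
  subst hr
  obtain ⟨f, hf, rfl⟩ := ContinuousCohomology.exists_crossedHomClass_eq _ η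
  unfold cyclotomeModH1Pull
  rw [ContinuousCohomology.map_crossedHomClass, res_crossedHomClass_eq_zero_iff,
    res_crossedHomClass_eq_zero_iff]
  constructor
  · rintro ⟨v, hv⟩
    refine ⟨v, ?_⟩
    rintro ⟨y, hy⟩
    obtain ⟨d, hd, rfl⟩ := Subgroup.mem_map.mp hy
    exact hv ⟨d, hd⟩
  · rintro ⟨v, hv⟩
    refine ⟨v, fun d => ?_⟩
    exact hv ⟨φ.arith d, Subgroup.mem_map_of_mem _ d.2⟩

/-- **Restriction after change of coefficients along a base change**: for a base-change homomorphism
`f : E → F` (`M_E(Λ) ⥲ M_F(Λ)`, abc-iut-w5-d099's `cyclotomeModPush_bijective_of_isBaseChange`),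
`(f_* η)|_D = 0 ↔ η|_D = 0`. [cite: MochizukiAbsTopIII2015, Thm 1.9 (d) p.37] -/
theorem res_push_eq_zero_iff (f : E ⟶ F) (hf : f.IsBaseChange) (D : Subgroup E'.arith)
    (η : cyclotomeModH1 r Λ) :
    (cyclotomeModH1Res (r ≫ f) Λ D).hom ((cyclotomeModH1Push Λ r f).hom η) = 0 ↔
      (cyclotomeModH1Res r Λ D).hom η = 0 := by
  obtain ⟨c, hc, rfl⟩ := ContinuousCohomology.exists_crossedHomClass_eq _ η
  have hbij := cyclotomeModPush_bijective_of_isBaseChange Λ hf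
  unfold cyclotomeModH1Push
  rw [ContinuousCohomology.map_crossedHomClass, res_crossedHomClass_eq_zero_iff,
    res_crossedHomClass_eq_zero_iff]
  constructor
  · rintro ⟨w, hw⟩
    obtain ⟨v, rfl⟩ := hbij.2 w
    refine ⟨v, fun d => hbij.1 ?_⟩
    have h1 := hw d
    change cyclotomeModPush Λ f (c d) = _ at h1
    rw [h1, map_sub, cyclotomeModPush_act]
    rfl
  · rintro ⟨v, hv⟩
    refine ⟨cyclotomeModPush Λ f v, fun d => ?_⟩
    change cyclotomeModPush Λ f (c d) = _
    rw [hv d, map_sub, cyclotomeModPush_act]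
    rfl

end Res

end Literature.AnabelianGeometry.AbsoluteAnabelian.AbsTopIII
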